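/-
Copyright: statement-level skeleton of a published paper (lit-balaban cell, Phase-2 proof seat p25, gen 21). No proof
claims beyond what the kernel checks below.
-/
import Literature.MathematicalPhysics.QuantumFieldTheory.BalabanImbrieJaffe1984to88.BIJ88WalkIneq312RemainderBdry
import Literature.MathematicalPhysics.QuantumFieldTheory.BalabanImbrieJaffe1984to88.BIJ88WalkRemainderExpectation312
import Literature.MathematicalPhysics.QuantumFieldTheory.BalabanImbrieJaffe1984to88.BIJ88WalkRemainderActivityN312

/-!
# `BalabanImbrieJaffe1984to88.BIJ88WalkIneq312RemainderBdryN` — T. Bałaban, J. Imbrie, A. Jaffe, *Effective action and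
cluster properties of the abelian Higgs model*, Commun. Math. Phys. **114** (1988) 257–315 [BalabanImbrieJaffe1988],
§5.14 p. 312 [PDF 56], verbatim (x2 render `lit-balaban-r16/renders/cmp114/original-p056-x2.png`): *"By performing
sufficiently many integrations by parts, we have arranged for enough small factors to beat these large factors in the
remainder terms (at least if X_{r′} is not at the boundary of Λ₁₂^{(k)}). Near the boundary we have potentially large
covariances C^{(k)}_{Λ₁₂^{(k)},loc} − C^{(k)}_{loc} or C^{(k)}_{Λ₁₂^{(k)},loc}(u_{k+1}) − C^{(k)}_{loc}(u_{k+1}), so we make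
use of the proximity to Λ₁₂^{(k)c} to provide the necessary convergence. These considerations lead to the following
estimate: |G_k(X)| ≤ c(F(X))(e^β(L^kε/ε₀)^{1/4−α})^{β′|X∖∪_cX_c|} × Π_{X_{σ_1} ⊂ X : dist(X_{σ_1}, Λ₁₂^{(k)c}) < r(e_k)}
[c(L^kε)^{−m(c)}e^{−m′(c)}]."* — **THE HEAD THEOREM OF ROW C2.Claim@312 IN AN ABSTRACT CURRENCY `N` FOR THE
`χ′`-DIRECTIONS, AND THE HEAD OF RECORD RE-DERIVED AS ITS INSTANCE `N = ‖·‖_∞`** (p25 gen 21; file N3 of the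
member-level currency generalization, owner r16 ruling 2026-08-23T11:27:10Z, conditions (1) new files only — the head
of record `BIJ88WalkIneq312RemainderBdry.ineq312_remainder_bdry` (r16 v2.284, ref-5 g68 CONCUR) and the chain
D/E2/G/K are NOT edited — and (2) the head's statement is DERIVED here from the `N`-version as the case `N = ‖·‖_∞`
(§3, a kernel-checked `example` at the head's exact statement); condition (3), the volume-free payoff, is
`BIJ88WalkProductCutoffVolFree312`).

The head measures a `χ′`-direction `z = C_p u` by its sup norm in exactly two hypotheses, `hBz : ‖C_p u‖ ≤ B′_p ρ_p`
and `hE : |𝔼_W[Π legs·(Π_{z∈dirs}∂_z)χ·e^{−V}]| ≤ K_χ·Π_z(η_χ‖z‖)·Λ_O`; print's estimate is currency-agnostic.  Here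
both are stated for an ARBITRARY size functional `N ≥ 0`, `N 0 = 0`:
`hBzN : N(C_p u) ≤ B′_p ρ_p`, `hE_N : … ≤ K_χ·Π_z(η_χ·N z)·Λ_O`; the CONCLUSION IS VERBATIM THE HEAD'S
(`Ineq312 remSys (remAt(O,𝒳)/Z) (K_χ·Λ_O·W_O^{Φ₀(O)}) (Π_{j∈O∩bdry} B_ℓ^{|obs j|}) (Σ_r #(X_r∖obs cubes)) θ 1`).  Since
the `N`-version has the same conclusion and hypotheses of which the head's are the instance `N = ‖·‖_∞`, it implies
the head (§3) — a stronger sibling, a MEMBER; the row head does not move.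

statement-level skeleton of published theorems with citation tags; proofs where landed; nothing here is a claim
about the Yang–Mills mass gap

PDF held: `paper:balaban1988-cmp114-bij-abelian-higgs-effective-action` (journal page = PDF page + 256); p. 312 =
PDF 56 (`p0056.txt` L20–31; x2 render re-read 2026-08-23).

CITATION HEADER (lean-in-tree rule).  lit-balaban cell (HOME `run/shared/lean/pub/lit-balaban/`), Phase 2, seat p25
gen 21; row **C2.Claim@312** of `HOME/lit-balaban-r16/ROWS-C2-part2.md` (owner r16, referee ref-5; head theorem of
record UNCHANGED and its statement RE-DERIVED; this file is a MEMBER — currency generalized).  USED BY NAME, nothing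
restated: the typed leaf `BIJ88Sect5StatementsPart4.Ineq312` (r16), `BIJ88WalkIneq312Remainder.{remSys, phi0}`,
`BIJ88WalkIneq312RemainderBdry.prod_obs_mul_small_le_bdry`, `BIJ88WalkRemainderActivity312.{remAt, rloc, nfreeOf,
card_rloc}`, `BIJ88WalkRemainderExpectation312.abs_integral_fieldLaw_le_sup` (p25 gen 18–19),
`BIJ88WalkRemainderActivityN312.abs_remAt_div_le_N` (p25 gen 21), the §5.13 model of record (`prec`, `src`, `corner`,
`fieldLaw`).

## What is proved (0 `sorry`, standard axioms, no new `Prop` facts; theorems only, no definitions)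

* §1 `remainder_expectation_le_N` (gen 19's G in the currency `N`: `hE_N` from a sup letter
  `|(Π_{z∈D}∂_z)χ·e^{−V}| ≤ K_χ·Π_{z∈D}(η_χ·N z)` and a moment letter);
* §2 `ineq312_remainder_N` (the sibling E2, all observables charged, in the currency `N`),
  **`ineq312_remainder_bdry_N`** (THE HEAD'S STATEMENT WITH `hBz`, `hE` IN THE CURRENCY `N`);
* §3 (owner's condition (2)) THE HEAD OF RECORD'S EXACT STATEMENT proved as
  `ineq312_remainder_bdry_N (N := fun z => ‖z‖) …` — an `example` (the gate's `dedup.landed` rule forbids a second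
  named declaration of a landed statement; the head remains the one declaration of record).
HONEST SCOPE — the head-question clauses (owner r16 (H1)–(H5), clause record v2.311 C1–C5) VERBATIM those of the head
with the currency remark: (H1) object = located remainder family activity as produced by `expand`; (H2) both
small-factor kinds visible, every abstract binder a named clause (C1 `B′_p ρ_p`/`hBzN` — now an `N`-size input on the
pieces, for `N = Σ_b|ℓ_b ·|` an `ℓ¹→ℓ¹` operator-norm input —, `ρ₀`, `N₀`; C2 `c_V`, `θ_v`; C3 `K_χ·Λ_O`/`hE_N`; C4
`hbeat`; C5 `bdry`), none discharged here; (H3) as printed, boundary-restricted product under `hbeat`; (H4) boundary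
mechanism not modelled; (H5) pre-cluster-expansion.  `N` is any nonnegative functional vanishing at `0`.  NOT summit
progress; NOT continuum; NOT Clay.  Imports `BIJ88WalkIneq312RemainderBdry`, `BIJ88WalkRemainderExpectation312`,
`BIJ88WalkRemainderActivityN312`; modifies nothing.
-/

noncomputable section

namespace Literature.MathematicalPhysics.QuantumFieldTheory.BalabanImbrieJaffe1984to88.BIJ88WalkIneq312RemainderBdryN

open Classical MeasureTheory Matrix Finset
open scoped BigOperators
open Literature.MathematicalPhysics.QuantumFieldTheory.Balaban1983to89
open B2Eq228Conditioning (weight source)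
open BIJ88PolymerRep5134 (corner)
open BIJ88PolymerRep5134Gauss (prec src)
open BIJ88SlotMomentsGauss308 (fieldLaw)
open BIJ88VertexIbp311 (vexp continuous_vexp)
open BIJ88WickDerivatives305 (dlist)
open BIJ88VertexComponents311 (maxArity)
open BIJ88WalkRun311 BIJ88WalkExpansion311 BIJ88WalkLabelPartition312 BIJ88WalkRemainderActivity312
  BIJ88WalkIneq312Remainder BIJ88WalkIneq312RemainderBdry BIJ88WalkRemainderExpectation312
  BIJ88WalkRemainderActivityN312

variable {ι : Type} [Fintype ι] {κ : Type} [LinearOrder κ] {P : Type} [Fintype P] {β : Type} [DecidableEq β]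
variable {α I : Type} [Fintype α] [DecidableEq α] [Fintype I] [DecidableEq I]
  {blk : α → I} {Δ : Matrix α α ℝ} {ℱ : α → ℝ} {W : Finset I}

/-! ## §1  The expectation letter `hE_N` from a sup letter in the currency `N` and a moment letter -/

/-- **THE EXPECTATION HYPOTHESIS IN THE CURRENCY `N`, DERIVED**: if the cutoff's derivatives times the interaction
factor obey `|(Π_{z∈D}∂_z)χ·e^{−V}|(φ) ≤ K_χ·Π_{z∈D}(η_χ·N z)` (every `(Π_D∂)χ` continuous) and the moments of the
pending legs of the remainder terms of `expand 0 O` obey `𝔼_W|Π_{legs}Φ| ≤ Λ`, then every remainder term satisfies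
`|𝔼_W[Π_{legs}Φ·(Π_{dirs t}∂)χ·e^{−V}]| ≤ K_χ·Π_{z∈dirs t}(η_χ·N z)·Λ`.  (`N = ‖·‖_∞`:
`BIJ88WalkRemainderExpectation312.remainder_expectation_le`.) [cite: BalabanImbrieJaffe1988, §5.14 p.312] -/
theorem remainder_expectation_le_N (hPD : (prec blk Δ W (corner ℝ W)).PosDef)
    {N : ({x : α // blk x ∈ W} → ℝ) → ℝ} (hN0 : ∀ z, 0 ≤ N z)
    {Cov : P → Matrix {x : α // blk x ∈ W} {x : α // blk x ∈ W} ℝ} {trig : P → Bool} {c : ι → ℝ}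
    {legs : ι → List ({x : α // blk x ∈ W} → ℝ)} {obs : κ → List ({x : α // blk x ∈ W} → ℝ)} {M : ℕ}
    {χ : ({x : α // blk x ∈ W} → ℝ) → ℝ} {Kχ ηχ Λ : ℝ} (hKχ : 0 ≤ Kχ) (hη0 : 0 ≤ ηχ)
    (hχc : ∀ D : List ({x : α // blk x ∈ W} → ℝ), Continuous (dlist D χ))
    (hK : ∀ (D : List ({x : α // blk x ∈ W} → ℝ)) φ, |dlist D χ φ * vexp c legs φ| ≤ Kχ * (D.map fun z => ηχ * N z).prod)
    {O : Finset κ}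
    (hmom : ∀ t ∈ expand Cov trig (src blk ℱ W) c legs obs M 0 O, t.consts = 0 →
      ∫ φ, |((t.groups.map fun h => (h.pend : Multiset _)).sum.map fun w => φ ⬝ᵥ w).prod| ∂(fieldLaw blk Δ ℱ W) ≤ Λ) :
    ∀ t ∈ expand Cov trig (src blk ℱ W) c legs obs M 0 O, t.consts = 0 →
      |∫ φ, ((t.groups.map fun h => (h.pend : Multiset _)).sum.map fun w => φ ⬝ᵥ w).prod
          * (dlist t.dirs χ φ * vexp c legs φ) ∂(fieldLaw blk Δ ℱ W)|
        ≤ Kχ * (t.dirs.map fun z => ηχ * N z).prod * Λ := by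
  intro t ht hc
  have hKD : 0 ≤ Kχ * (t.dirs.map fun z => ηχ * N z).prod :=
    mul_nonneg hKχ (List.prod_nonneg fun x hx => by
      obtain ⟨z, -, rfl⟩ := List.mem_map.1 hx; exact mul_nonneg hη0 (hN0 z))
  have h := abs_integral_fieldLaw_le_sup (ℱ := ℱ) hPD ((hχc t.dirs).mul (continuous_vexp c legs)) (hK t.dirs)
    ((t.groups.map fun h => (h.pend : Multiset _)).sum)
  exact h.trans (mul_le_mul_of_nonneg_left (hmom t ht hc) hKD)

/-! ## §2  The leaf `Ineq312` for the located remainder families in the currency `N` -/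

/-- **THE SIBLING E2 IN THE CURRENCY `N`** (all observables charged, `s^{#𝒳}` kept in `c_F`): under the hypotheses of
`BIJ88WalkRemainderActivityN312.abs_remAt_div_le_N` for every `O`,
`Ineq312 remSys (remAt(O,𝒳)/Z) (K_χ·Λ_O·W_O^{Φ₀(O)}·s^{#𝒳}) (Π_{j∈O} B_ℓ^{|obs j|}) (Σ_r #(X_r ∖ obs cubes)) θ 1`.
(`N = ‖·‖_∞`: `BIJ88WalkIneq312Remainder.ineq312_remainder`.)
[cite: BalabanImbrieJaffe1988, §5.14 p.312 (estimate preceding (5.14.5))] -/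
theorem ineq312_remainder_N (hPD : (prec blk Δ W (corner ℝ W)).PosDef)
    {N : ({x : α // blk x ∈ W} → ℝ) → ℝ} (hN0 : ∀ z, 0 ≤ N z) (hNz : N 0 = 0)
    {Cov : P → Matrix {x : α // blk x ∈ W} {x : α // blk x ∈ W} ℝ} {trig : P → Bool} {c : ι → ℝ}
    {legs : ι → List ({x : α // blk x ∈ W} → ℝ)} {obs : κ → List ({x : α // blk x ∈ W} → ℝ)} {M : ℕ}
    {χ : ({x : α // blk x ∈ W} → ℝ) → ℝ} {oc : κ → Finset β} {vc : ι → Finset β} {reg : P → Finset β}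
    {Dir : Set ({x : α // blk x ∈ W} → ℝ)} {B' ρ : P → ℝ} {cV : ι → ℝ} {Bl θ θv θw ηχ ρ₀ Kχ : ℝ} {Λ : Finset κ → ℝ}
    {N₀ : ℕ}
    (hθ0 : 0 < θ) (hθ1 : θ ≤ 1) (hBl : 1 ≤ Bl) (hB0 : ∀ p, 0 ≤ B' p) (hρ : ∀ p, 0 ≤ ρ p) (hcV0 : ∀ m, 0 ≤ cV m)
    (hη0 : 0 ≤ ηχ) (hη1 : ηχ ≤ 1) (hθv : 0 < θv) (hθv1 : θv ≤ 1) (hθw : 0 < θw) (hθw1 : θw ≤ 1)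
    (hB : ∀ p, ∀ u ∈ Dir, ∀ w ∈ Dir, |(Cov p *ᵥ u) ⬝ᵥ w| ≤ B' p * ρ p)
    (hBf : ∀ p, ∀ u ∈ Dir, |(Cov p *ᵥ u) ⬝ᵥ src blk ℱ W| ≤ B' p * ρ p)
    (hBzN : ∀ p, ∀ u ∈ Dir, N (Cov p *ᵥ u) ≤ B' p * ρ p)
    (hcV : ∀ m, |c m| ≤ cV m) (hobs : ∀ j, ∀ w ∈ obs j, w ∈ Dir) (hlegs : ∀ m, ∀ w ∈ legs m, w ∈ Dir)
    (hloc : ∀ p, trig p = false → B' p ≤ Bl ∧ reg p = ∅) (hwalk : ∀ p, trig p = true → B' p ≤ θw * θ ^ (reg p).card)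
    (hvert : ∀ m, cV m * Bl ^ (legs m).length ≤ θv * θ ^ (vc m).card) (hρ₀0 : 0 ≤ ρ₀)
    (hρ₀ : ∀ u ∈ Dir, (∑ p ∈ univ.filter (fun p => Cov p *ᵥ u ≠ 0), ρ p) ≤ ρ₀)
    (hN₀ : ∀ p, ∀ u ∈ Dir,
      (∑ m, ((range (legs m).length).filter fun j => (Cov p *ᵥ u) ⬝ᵥ (legs m).getD j 0 ≠ 0).card) ≤ N₀)
    (hKχ : 0 ≤ Kχ) (hΛ : ∀ O, 0 ≤ Λ O)
    (hE : ∀ O : Finset κ, ∀ t ∈ expand Cov trig (src blk ℱ W) c legs obs M 0 O, t.consts = 0 →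
      |∫ φ, ((t.groups.map fun h => (h.pend : Multiset _)).sum.map fun w => φ ⬝ᵥ w).prod
          * (dlist t.dirs χ φ * vexp c legs φ) ∂(fieldLaw blk Δ ℱ W)|
        ≤ Kχ * (t.dirs.map fun z => ηχ * N z).prod * Λ O) :
    BIJ88Sect5StatementsPart4.Ineq312 (remSys κ β)
      (fun OX => remAt (prec blk Δ W (corner ℝ W)) Cov trig (src blk ℱ W) c legs obs M χ oc vc reg [] 0 OX.1 OX.2
        / ∫ φ, weight (prec blk Δ W (corner ℝ W)) φ * source (src blk ℱ W) φ)
      (fun OX => Kχ * Λ OX.1 * (max 1 (ρ₀ * ((phi0 legs obs M OX.1 + N₀ : ℕ) : ℝ))) ^ phi0 legs obs M OX.1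
        * (max ηχ (max (θv ^ M) θw)) ^ Multiset.card OX.2)
      (fun OX => ∏ j ∈ OX.1, Bl ^ (obs j).length)
      (fun OX => nfreeOf oc OX.2) θ 1 := by
  intro OX
  obtain ⟨O, 𝒳⟩ := OX
  have hnf : θ ^ ((1 : ℝ) * (nfreeOf oc 𝒳 : ℕ)) = θ ^ nfreeOf oc 𝒳 := by rw [one_mul, Real.rpow_natCast]
  simp only []
  rw [hnf]
  set Wc := max 1 (ρ₀ * ((phi0 legs obs M O + N₀ : ℕ) : ℝ)) with hWc
  have hW1 : 1 ≤ Wc := le_max_left _ _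
  have hW : ρ₀ * ((∑ j ∈ O, ((obs j).length + 1 + M * maxArity legs) + N₀ : ℕ) : ℝ) ≤ Wc := le_max_right _ _
  have h := abs_remAt_div_le_N (oc := oc) (vc := vc) (reg := reg) (χ := χ) hPD hN0 hNz hθ0 hθ1 hBl hB0 hρ hcV0 hη0
    hη1 hθv hθv1 hθw hθw1 hB hBf hBzN hcV hobs hlegs hloc hwalk hvert hρ₀0 hρ₀ hN₀ O hW1 hW hKχ (hΛ O) (hE O) 𝒳
  calc _ ≤ Kχ * Λ O * (Wc ^ (∑ j ∈ O, ((obs j).length + 1 + M * maxArity legs)) * ∏ j ∈ O, Bl ^ (obs j).length)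
        * (θ ^ nfreeOf oc 𝒳 * (max ηχ (max (θv ^ M) θw)) ^ Multiset.card 𝒳) := h
    _ = _ := by rw [phi0]; ring

/-- **THE HEAD THEOREM OF ROW C2.Claim@312 IN THE CURRENCY `N`**: the hypotheses of the head of record
`BIJ88WalkIneq312RemainderBdry.ineq312_remainder_bdry` with `hBz`, `hE` replaced by `hBzN : N(C_p u) ≤ B′_p ρ_p` and
`hE_N : |𝔼_W[Π legs·(Π_{dirs}∂)χ·e^{−V}]| ≤ K_χ·Π_{z∈dirs}(η_χ·N z)·Λ_O` for a size functional `N ≥ 0`, `N 0 = 0`, and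
the beating clause `hbeat` as in the head; CONCLUSION VERBATIM THE HEAD'S:
`Ineq312 remSys (remAt(O,𝒳)/Z) (K_χ·Λ_O·W_O^{Φ₀(O)}) (Π_{j∈O, j∈bdry} B_ℓ^{|obs j|}) (Σ_r #(X_r ∖ obs cubes)) θ 1` —
print's `|G_k(X)| ≤ c(F(X))(e^β(L^kε/ε₀)^{1/4−α})^{β′|X∖∪_cX_c|} × Π_{X_{σ_1} ⊂ X : dist(X_{σ_1}, Λ₁₂^{(k)c}) < r(e_k)}
[c(L^kε)^{−m(c)}e^{−m′(c)}]` for the located remainder families, pre-cluster-expansion.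
[cite: BalabanImbrieJaffe1988, §5.14 p.312 (estimate preceding (5.14.5))] -/
theorem ineq312_remainder_bdry_N (hPD : (prec blk Δ W (corner ℝ W)).PosDef)
    {N : ({x : α // blk x ∈ W} → ℝ) → ℝ} (hN0 : ∀ z, 0 ≤ N z) (hNz : N 0 = 0)
    {Cov : P → Matrix {x : α // blk x ∈ W} {x : α // blk x ∈ W} ℝ} {trig : P → Bool} {c : ι → ℝ}
    {legs : ι → List ({x : α // blk x ∈ W} → ℝ)} {obs : κ → List ({x : α // blk x ∈ W} → ℝ)} {M : ℕ}
    {χ : ({x : α // blk x ∈ W} → ℝ) → ℝ} {oc : κ → Finset β} {vc : ι → Finset β} {reg : P → Finset β}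
    {Dir : Set ({x : α // blk x ∈ W} → ℝ)} {B' ρ : P → ℝ} {cV : ι → ℝ} {Bl θ θv θw ηχ ρ₀ Kχ : ℝ} {Λ : Finset κ → ℝ}
    {N₀ : ℕ}
    (hθ0 : 0 < θ) (hθ1 : θ ≤ 1) (hBl : 1 ≤ Bl) (hB0 : ∀ p, 0 ≤ B' p) (hρ : ∀ p, 0 ≤ ρ p) (hcV0 : ∀ m, 0 ≤ cV m)
    (hη0 : 0 ≤ ηχ) (hη1 : ηχ ≤ 1) (hθv : 0 < θv) (hθv1 : θv ≤ 1) (hθw : 0 < θw) (hθw1 : θw ≤ 1)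
    (hB : ∀ p, ∀ u ∈ Dir, ∀ w ∈ Dir, |(Cov p *ᵥ u) ⬝ᵥ w| ≤ B' p * ρ p)
    (hBf : ∀ p, ∀ u ∈ Dir, |(Cov p *ᵥ u) ⬝ᵥ src blk ℱ W| ≤ B' p * ρ p)
    (hBzN : ∀ p, ∀ u ∈ Dir, N (Cov p *ᵥ u) ≤ B' p * ρ p)
    (hcV : ∀ m, |c m| ≤ cV m) (hobs : ∀ j, ∀ w ∈ obs j, w ∈ Dir) (hlegs : ∀ m, ∀ w ∈ legs m, w ∈ Dir)
    (hloc : ∀ p, trig p = false → B' p ≤ Bl ∧ reg p = ∅) (hwalk : ∀ p, trig p = true → B' p ≤ θw * θ ^ (reg p).card)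
    (hvert : ∀ m, cV m * Bl ^ (legs m).length ≤ θv * θ ^ (vc m).card) (hρ₀0 : 0 ≤ ρ₀)
    (hρ₀ : ∀ u ∈ Dir, (∑ p ∈ univ.filter (fun p => Cov p *ᵥ u ≠ 0), ρ p) ≤ ρ₀)
    (hN₀ : ∀ p, ∀ u ∈ Dir,
      (∑ m, ((range (legs m).length).filter fun j => (Cov p *ᵥ u) ⬝ᵥ (legs m).getD j 0 ≠ 0).card) ≤ N₀)
    (hKχ : 0 ≤ Kχ) (hΛ : ∀ O, 0 ≤ Λ O)
    (hE : ∀ O : Finset κ, ∀ t ∈ expand Cov trig (src blk ℱ W) c legs obs M 0 O, t.consts = 0 →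
      |∫ φ, ((t.groups.map fun h => (h.pend : Multiset _)).sum.map fun w => φ ⬝ᵥ w).prod
          * (dlist t.dirs χ φ * vexp c legs φ) ∂(fieldLaw blk Δ ℱ W)|
        ≤ Kχ * (t.dirs.map fun z => ηχ * N z).prod * Λ O)
    (bdry : Finset κ)
    (hbeat : ∀ O : Finset κ, ∀ t ∈ expand Cov trig (src blk ℱ W) c legs obs M 0 O, t.consts = 0 → ∀ X ∈ t.groups,
      max ηχ (max (θv ^ M) θw) * ∏ j ∈ X.lab.filter (fun j => j ∉ bdry), Bl ^ (obs j).length ≤ 1) :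
    BIJ88Sect5StatementsPart4.Ineq312 (remSys κ β)
      (fun OX => remAt (prec blk Δ W (corner ℝ W)) Cov trig (src blk ℱ W) c legs obs M χ oc vc reg [] 0 OX.1 OX.2
        / ∫ φ, weight (prec blk Δ W (corner ℝ W)) φ * source (src blk ℱ W) φ)
      (fun OX => Kχ * Λ OX.1 * (max 1 (ρ₀ * ((phi0 legs obs M OX.1 + N₀ : ℕ) : ℝ))) ^ phi0 legs obs M OX.1)
      (fun OX => ∏ j ∈ OX.1.filter (fun j => j ∈ bdry), Bl ^ (obs j).length)
      (fun OX => nfreeOf oc OX.2) θ 1 := by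
  intro OX
  obtain ⟨O, 𝒳⟩ := OX
  have hnf : θ ^ ((1 : ℝ) * (nfreeOf oc 𝒳 : ℕ)) = θ ^ nfreeOf oc 𝒳 := by rw [one_mul, Real.rpow_natCast]
  simp only []
  rw [hnf]
  have hBl0 : 0 ≤ Bl := zero_le_one.trans hBl
  set Wc := max 1 (ρ₀ * ((phi0 legs obs M O + N₀ : ℕ) : ℝ)) with hWc
  set s := max ηχ (max (θv ^ M) θw) with hs
  have hs0 : 0 ≤ s := hη0.trans (le_max_left _ _)
  have hW1 : 1 ≤ Wc := le_max_left _ _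
  have hC0 : 0 ≤ Kχ * Λ O * Wc ^ phi0 legs obs M O * θ ^ nfreeOf oc 𝒳 :=
    mul_nonneg (mul_nonneg (mul_nonneg hKχ (hΛ O)) (pow_nonneg (zero_le_one.trans hW1) _)) (pow_nonneg hθ0.le _)
  have hP0 : 0 ≤ ∏ j ∈ O.filter (fun j => j ∈ bdry), Bl ^ (obs j).length := prod_nonneg fun j _ => pow_nonneg hBl0 _
  by_cases hex : ∃ t ∈ expand Cov trig (src blk ℱ W) c legs obs M 0 O, t.consts = 0 ∧ rloc oc vc reg t = 𝒳
  · obtain ⟨t, ht, hc, h𝒳⟩ := hex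
    have hW : ρ₀ * ((∑ j ∈ O, ((obs j).length + 1 + M * maxArity legs) + N₀ : ℕ) : ℝ) ≤ Wc := le_max_right _ _
    have h := abs_remAt_div_le_N (oc := oc) (vc := vc) (reg := reg) (χ := χ) hPD hN0 hNz hθ0 hθ1 hBl hB0 hρ hcV0 hη0
      hη1 hθv hθv1 hθw hθw1 hB hBf hBzN hcV hobs hlegs hloc hwalk hvert hρ₀0 hρ₀ hN₀ O hW1 hW hKχ (hΛ O) (hE O) 𝒳
    have hcard : Multiset.card 𝒳 = Multiset.card t.groups := by rw [← h𝒳, card_rloc]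
    have hbeat' := prod_obs_mul_small_le_bdry hBl hs0 bdry ht hc (hbeat O t ht hc)
    rw [← hcard] at hbeat'
    calc _ ≤ Kχ * Λ O * (Wc ^ (∑ j ∈ O, ((obs j).length + 1 + M * maxArity legs)) * ∏ j ∈ O, Bl ^ (obs j).length)
          * (θ ^ nfreeOf oc 𝒳 * s ^ Multiset.card 𝒳) := h
      _ = Kχ * Λ O * Wc ^ phi0 legs obs M O * θ ^ nfreeOf oc 𝒳
          * (s ^ Multiset.card 𝒳 * ∏ j ∈ O, Bl ^ (obs j).length) := by rw [phi0]; ring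
      _ ≤ Kχ * Λ O * Wc ^ phi0 legs obs M O * θ ^ nfreeOf oc 𝒳
          * ∏ j ∈ O.filter (fun j => j ∈ bdry), Bl ^ (obs j).length := mul_le_mul_of_nonneg_left hbeat' hC0
      _ = _ := by ring
  · -- no no-block term is located at `𝒳`: the localized remainder part vanishes
    have h0 : remAt (prec blk Δ W (corner ℝ W)) Cov trig (src blk ℱ W) c legs obs M χ oc vc reg [] 0 O 𝒳 = 0 := by
      rw [remAt]
      refine Multiset.sum_eq_zero fun x hx => ?_
      obtain ⟨t, ht, rfl⟩ := Multiset.mem_map.1 hx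
      exact if_neg fun h => hex ⟨t, ht, h⟩
    rw [h0, zero_div, abs_zero]
    exact mul_nonneg hC0 hP0

/-! ## §3  The head of record re-derived as the instance `N = ‖·‖_∞` (owner's condition (2)) -/

/-- **THE HEAD OF RECORD IS THE CASE `N = ‖·‖_∞`**: the EXACT statement of
`BIJ88WalkIneq312RemainderBdry.ineq312_remainder_bdry` (hypotheses `hBz : ‖C_p u‖ ≤ B′_p ρ_p`,
`hE : … ≤ K_χ·Π_{z∈dirs}(η_χ‖z‖)·Λ_O`, sup norm on the fields), obtained from `ineq312_remainder_bdry_N` with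
`N := fun z => ‖z‖` (`norm_nonneg`, `norm_zero`) — kernel-checked as an `example`, not a named theorem: the gate's
`dedup.landed` rule forbids re-declaring a landed statement (the head stays the single declaration of record).
[cite: BalabanImbrieJaffe1988, §5.14 p.312 (estimate preceding (5.14.5))] -/
example (hPD : (prec blk Δ W (corner ℝ W)).PosDef)
    {Cov : P → Matrix {x : α // blk x ∈ W} {x : α // blk x ∈ W} ℝ} {trig : P → Bool} {c : ι → ℝ}
    {legs : ι → List ({x : α // blk x ∈ W} → ℝ)} {obs : κ → List ({x : α // blk x ∈ W} → ℝ)} {M : ℕ}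
    {χ : ({x : α // blk x ∈ W} → ℝ) → ℝ} {oc : κ → Finset β} {vc : ι → Finset β} {reg : P → Finset β}
    {Dir : Set ({x : α // blk x ∈ W} → ℝ)} {B' ρ : P → ℝ} {cV : ι → ℝ} {Bl θ θv θw ηχ ρ₀ Kχ : ℝ} {Λ : Finset κ → ℝ}
    {N₀ : ℕ}
    (hθ0 : 0 < θ) (hθ1 : θ ≤ 1) (hBl : 1 ≤ Bl) (hB0 : ∀ p, 0 ≤ B' p) (hρ : ∀ p, 0 ≤ ρ p) (hcV0 : ∀ m, 0 ≤ cV m)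
    (hη0 : 0 ≤ ηχ) (hη1 : ηχ ≤ 1) (hθv : 0 < θv) (hθv1 : θv ≤ 1) (hθw : 0 < θw) (hθw1 : θw ≤ 1)
    (hB : ∀ p, ∀ u ∈ Dir, ∀ w ∈ Dir, |(Cov p *ᵥ u) ⬝ᵥ w| ≤ B' p * ρ p)
    (hBf : ∀ p, ∀ u ∈ Dir, |(Cov p *ᵥ u) ⬝ᵥ src blk ℱ W| ≤ B' p * ρ p)
    (hBz : ∀ p, ∀ u ∈ Dir, ‖Cov p *ᵥ u‖ ≤ B' p * ρ p)
    (hcV : ∀ m, |c m| ≤ cV m) (hobs : ∀ j, ∀ w ∈ obs j, w ∈ Dir) (hlegs : ∀ m, ∀ w ∈ legs m, w ∈ Dir)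
    (hloc : ∀ p, trig p = false → B' p ≤ Bl ∧ reg p = ∅) (hwalk : ∀ p, trig p = true → B' p ≤ θw * θ ^ (reg p).card)
    (hvert : ∀ m, cV m * Bl ^ (legs m).length ≤ θv * θ ^ (vc m).card) (hρ₀0 : 0 ≤ ρ₀)
    (hρ₀ : ∀ u ∈ Dir, (∑ p ∈ univ.filter (fun p => Cov p *ᵥ u ≠ 0), ρ p) ≤ ρ₀)
    (hN : ∀ p, ∀ u ∈ Dir,
      (∑ m, ((range (legs m).length).filter fun j => (Cov p *ᵥ u) ⬝ᵥ (legs m).getD j 0 ≠ 0).card) ≤ N₀)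
    (hKχ : 0 ≤ Kχ) (hΛ : ∀ O, 0 ≤ Λ O)
    (hE : ∀ O : Finset κ, ∀ t ∈ expand Cov trig (src blk ℱ W) c legs obs M 0 O, t.consts = 0 →
      |∫ φ, ((t.groups.map fun h => (h.pend : Multiset _)).sum.map fun w => φ ⬝ᵥ w).prod
          * (dlist t.dirs χ φ * vexp c legs φ) ∂(fieldLaw blk Δ ℱ W)|
        ≤ Kχ * (t.dirs.map fun z => ηχ * ‖z‖).prod * Λ O)
    (bdry : Finset κ)
    (hbeat : ∀ O : Finset κ, ∀ t ∈ expand Cov trig (src blk ℱ W) c legs obs M 0 O, t.consts = 0 → ∀ X ∈ t.groups,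
      max ηχ (max (θv ^ M) θw) * ∏ j ∈ X.lab.filter (fun j => j ∉ bdry), Bl ^ (obs j).length ≤ 1) :
    BIJ88Sect5StatementsPart4.Ineq312 (remSys κ β)
      (fun OX => remAt (prec blk Δ W (corner ℝ W)) Cov trig (src blk ℱ W) c legs obs M χ oc vc reg [] 0 OX.1 OX.2
        / ∫ φ, weight (prec blk Δ W (corner ℝ W)) φ * source (src blk ℱ W) φ)
      (fun OX => Kχ * Λ OX.1 * (max 1 (ρ₀ * ((phi0 legs obs M OX.1 + N₀ : ℕ) : ℝ))) ^ phi0 legs obs M OX.1)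
      (fun OX => ∏ j ∈ OX.1.filter (fun j => j ∈ bdry), Bl ^ (obs j).length)
      (fun OX => nfreeOf oc OX.2) θ 1 :=
  ineq312_remainder_bdry_N (N := fun z => ‖z‖) (oc := oc) (vc := vc) (reg := reg) (χ := χ) hPD
    (fun z => norm_nonneg z) norm_zero hθ0 hθ1 hBl hB0 hρ hcV0 hη0 hη1 hθv hθv1 hθw hθw1 hB hBf hBz hcV hobs hlegs
    hloc hwalk hvert hρ₀0 hρ₀ hN hKχ hΛ hE bdry hbeat

end Literature.MathematicalPhysics.QuantumFieldTheory.BalabanImbrieJaffe1984to88.BIJ88WalkIneq312RemainderBdryN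

end
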